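import Summits.BirchSwinnertonDyer.BirchSwinnertonDyer.Theorems.RankLeOneBSDpOfGlobalDivisibilityCertificate
import Literature.NumberTheory.EllipticCurves.BSDSelmerPConverseYanZhuKolyvaginSystemProofs
import Summits.BirchSwinnertonDyer.Rank1Residual.X11b.ZpLineIndex
import HarnessLib

/-!
# The CONDUCTOR-ONE level of the divisibility statement J is the index certificate: `p^M ∣ y_K` in
# `E(K[1])` for every `M ≤ ord_p [E(K):ℤ y_K]` — so J's research content lives at the GENUINE Kolyvagin
# levels `n > 1` (McCallum's `M_r`, `r ≥ 1`) (route-free; seat `bsd-wall-utd-p3` gen 1; file 6)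

The displayed input J of files 1–5 (`hglob`: every derived Heegner point `P_n` on the frame `(Dt, H.β, ι)`,
`n` square-free with Kolyvagin prime factors of index `≥ s′`, is `p^{s′}`-divisible in `E(K[n])` for all
`s′ ≤ ord_p ∏_ℓ c_ℓ(E) + s`) quantifies over `n = 1` too, where it says `y_K ∈ p^{s′} E(K[1])` — Jetchev's
«global divisibility of the Heegner point» `m₀ ≥ m_∞ ≥ …` (Thm. 1.4 at `p ∤ N`). In CERTIFICATE currency
this level is FREE: with `E(K)` of rank one without `p`-torsion (Kolyvagin + `E[p]` irreducible),
`ord_p [E(K):ℤP] = max{M : P ∈ p^M E(K)}` (McCallum Lemma 5.1), so an index certificate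
`ord_p ∏c + s ≤ ord_p [E(K):ℤP]` (the JET rows: equality) gives the `n = 1` clause outright.

* §1 `exists_pow_smul_eq_of_le_padicValNat_index` — abelian-group form: rank-one coordinate, finite torsion,
  no `p`-torsion, `P` of infinite order, `M ≤ ord_p [A:ℤP]` ⟹ `P ∈ p^M A`.
* §2 `pDiv_one_of_le_padicValNat_index` — for every conductor-`1` Kolyvagin–Heegner datum `d₁` on the frame
  of a Heegner point `P` (Shimura reciprocity: `P(1) = y_K = P`, tree theorem), `M ≤ ord_p [E(K):ℤP]` ⟹
  `Koly.PDiv d₁ p M`.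
* §3 `globalDivisibility_of_index_ge_of_higherLevels` — J ⟸ (`ord_p ∏c + s ≤ ord_p [E(K):ℤP]`) ∧ J restricted
  to `n ≠ 1`; and `bsdp_of_higherLevelDivisibility_of_index_eq_of_shaAnUnit` — file 4's JET certificate
  theorem with J replaced by its `n ≠ 1` part and the index certificate read as an EQUALITY.

HONEST FRAMING: CONDITIONAL on the displayed higher-level divisibility and the named facts; per pair; books
nothing; BSD is not proved for any curve by this file. No definition, no named fact, no `sorry`.

References: [McCallumLMS1991] §5 Lemma 5.1 (p. 303), `M_r` (p. 303), Cor. 5.6 (p. 310); [Jetchev2008] Thm. 1.4,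
Conj. 1.3 (p. 812); [GrossLMS1991] §4 (4.1) (`P_1 = y_K`); [JetchevSkinnerWan2017] Prop. 3.2.1, (7.1.5).
-/

noncomputable section

open scoped Classical

set_option linter.dupNamespace false
set_option autoImplicit false

namespace Summit.BirchSwinnertonDyer.BirchSwinnertonDyer.Theorems.SchneiderFree.Exact

open WeierstrassCurve NumberField IsDedekindDomain Field
  Literature.NumberTheory.EllipticCurves
  Literature.NumberTheory.EllipticCurves.ModularForms
  Literature.NumberTheory.EllipticCurves.Rank1Residual
  Literature.NumberTheory.EllipticCurves.Rank1Residual.Typed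
  Summit.BirchSwinnertonDyer.Rank1Residual
  Summit.BirchSwinnertonDyer.Rank1Residual.X11b
  Summit.BirchSwinnertonDyer.Rank1Residual.X11b.Three

/-! ### §1 Abelian-group form of McCallum's Lemma 5.1, the divisibility direction -/

/-- **`M ≤ ord_p [A : ℤP] ⟹ P ∈ p^M A`** for an abelian group `A` with a rank-one coordinate `c`
(`c Q = 1`, `ker c` torsion), finite torsion, no `p`-torsion, and `P` of infinite order: `ord_p [A:ℤP] =
ord_p |c(P)|` (`RankOne.padicValNat_index_zmultiples_eq`), so `p^M ∣ c(P)`, and `P − c(P)•Q` is torsion of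
order prime to `p`, hence `p^M`-divisible. [cite: McCallumLMS1991, §5 Lemma 5.1 (p. 303)]
[cite: JetchevSkinnerWan2017, Prop. 3.2.1 (arXiv:1512.06894 p. 10)] -/
theorem exists_pow_smul_eq_of_le_padicValNat_index {A : Type*} [AddCommGroup A] {p : ℕ} [Fact p.Prime]
    [Finite (AddCommGroup.torsion A)] (c : A →+ ℤ) (Q : A) (hQ : c Q = 1)
    (hker : ∀ x : A, c x = 0 → IsOfFinAddOrder x) (hiv : ∀ x : A, p • x = 0 → x = 0)
    (P : A) (hnt : ¬ IsOfFinAddOrder P) {M : ℕ} (hM : M ≤ padicValNat p (AddSubgroup.zmultiples P).index) :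
    ∃ R : A, ((p ^ M : ℕ) : ℤ) • R = P := by
  have hcP : c P ≠ 0 := fun h ↦ hnt (hker P h)
  rw [RankOne.padicValNat_index_zmultiples_eq c Q hQ hker hiv P hcP] at hM
  have hdvd : p ^ M ∣ (c P).natAbs := (padicValNat_dvd_iff_le (Int.natAbs_ne_zero.mpr hcP)).mpr hM
  obtain ⟨a, ha⟩ := Int.ofNat_dvd_left.mpr hdvd
  have ht : IsOfFinAddOrder (P - c P • Q) := RankOne.isOfFinAddOrder_sub_coord_zsmul c Q hQ hker P
  obtain ⟨t', ht'⟩ := LocalIndex.mem_range_nsmul_pow_of_isOfFinAddOrder hiv M ht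
  refine ⟨a • Q + t', ?_⟩
  have ht'' : (p ^ M) • t' = P - c P • Q := by rw [← nsmulAddMonoidHom_apply]; exact ht'
  rw [smul_add, smul_smul, ← ha, natCast_zsmul, ht'']
  abel

/-! ### §2 The conductor-one level of J from the index certificate -/

/-- **`M ≤ ord_p [E(K):ℤP] ⟹ P(1) ∈ p^M E(K[1])` for every conductor-`1` Kolyvagin–Heegner datum on the frame
of the Heegner point `P`.** For `W/ℚ` elliptic with `E[p]` irreducible, `K` imaginary quadratic Heegner for
`N`, `P ∈ E(K)` with `ι(P) = heegnerPointComplex Dt H` of infinite order (so `E(K)` has rank one by Kolyvagin,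
named fact `hKo`, and no `p`-torsion), and `d₁ : KolyvaginHeegnerData Dt H.β ι 1`: `P(1) = d₁.derivedPoint` is
the image of `P` (Gross's `P_1 = y_K`; Galois descent + Shimura reciprocity at conductor `1`, tree theorems
`heegnerSystem_exists_isHeegnerPoint_map_eq_derivedPoint_one`, `KolyvaginBottom.eq_of_map_eq_heegnerPointComplex`,
`heegnerPointOfConductor_one_galoisConj_holds`), and §1 makes `P` `p^M`-divisible in `E(K)`, hence `P(1)` in
`E(K[1])`. [cite: McCallumLMS1991, §5 Lemma 5.1 (p. 303)] [cite: GrossLMS1991, §4 (4.1)] -/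
theorem pDiv_one_of_le_padicValNat_index
    (hKo : ∀ (N : ℕ) [NeZero N] (W : WeierstrassCurve ℚ) (K : Type) [Field K] [NumberField K],
      kolyvagin N W K)
    (W : WeierstrassCurve ℚ) [W.IsElliptic] (p : ℕ) [Fact p.Prime] (hirr : W.HasIrreducibleModPGaloisRep p)
    {N : ℕ} [NeZero N] (K : Type) [Field K] [NumberField K] (hK : IsImaginaryQuadratic K)
    (hHH : SatisfiesHeegnerHypothesis N K) (Dt : ModularParametrizationData W N)
    (H : HeegnerDatum N (NumberField.discr K)) (ι : K →+* ℂ) (P : (W.baseChange K).toAffine.Point)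
    (hP : WeierstrassCurve.Affine.Point.map ι.toRatAlgHom P = heegnerPointComplex Dt H)
    (hnt : ¬ IsOfFinAddOrder P) (d₁ : KolyvaginHeegnerData Dt H.β ι 1) {M : ℕ}
    (hM : M ≤ padicValNat p (AddSubgroup.zmultiples P).index) :
    Koly.PDiv d₁ p M := by
  have hp : p.Prime := Fact.out
  -- `P(1)` is the image of `P`
  obtain ⟨P₀, -, hP₀⟩ := heegnerSystem_exists_isHeegnerPoint_map_eq_derivedPoint_one
    (heegnerPointOfConductor_one_galoisConj_holds N W K) hK hHH d₁
  have hPP : P₀ = P :=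
    KolyvaginBottom.eq_of_map_eq_heegnerPointComplex (heegnerPointOfConductor_one_galoisConj_holds N W K)
      hK hHH d₁ rfl hP hP₀
  subst hPP
  -- rank one, no `p`-torsion, finite torsion
  obtain ⟨hrank, -⟩ := hKo N W K hK hHH ⟨Dt, H, ι, hP⟩ hnt
  have hbot := torsionBy_eq_bot_of_isImaginaryQuadratic_of_hasIrreducibleModPGaloisRep W K hK hp hirr
  have hiv : ∀ x : (W.baseChange K).toAffine.Point, p • x = 0 → x = 0 := fun x hx ↦ by
    have hmem : x ∈ AddSubgroup.torsionBy (W.baseChange K).toAffine.Point ((p : ℕ) : ℤ) := by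
      rw [mem_torsionBy_iff, natCast_zsmul]
      exact hx
    rw [hbot] at hmem
    exact hmem
  haveI : Finite (AddCommGroup.torsion (W.baseChange K).toAffine.Point) :=
    WeierstrassCurve.finite_torsion_point (W := W.baseChange K)
  obtain ⟨c, Q, hcQ, hcker⟩ := RankOne.exists_coord_of_mordellWeilRank_eq_one (W.baseChange K) hrank
  obtain ⟨R, hR⟩ := exists_pow_smul_eq_of_le_padicValNat_index c Q hcQ hcker hiv P₀ hnt hM
  refine ⟨WeierstrassCurve.Affine.Point.map (algebraMap K (ringClassField K ι 1)).toRatAlgHom R, ?_⟩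
  rw [← map_zsmul, hR, hP₀]

/-! ### §3 J ⟸ the index certificate (level `1`) ∧ its genuine-Kolyvagin-level part (`n ≠ 1`) -/

/-- **J from the index certificate and the HIGHER levels only.** On the frame of a Heegner point `P` (data of
§2), if `ord_p ∏_ℓ c_ℓ(E) + s ≤ ord_p [E(K):ℤP]` (the JET index certificate read as `≥`) and every derived
Heegner point of GENUINE Kolyvagin level `n ≠ 1` satisfies the divisibility clause, then the full displayed
statement J (`hglob` of files 1–5) holds. [cite: McCallumLMS1991, §5 (M_r, p. 303) and Lemma 5.1] -/
theorem globalDivisibility_of_index_ge_of_higherLevels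
    (hKo : ∀ (N : ℕ) [NeZero N] (W : WeierstrassCurve ℚ) (K : Type) [Field K] [NumberField K],
      kolyvagin N W K)
    (W : WeierstrassCurve ℚ) [W.IsElliptic] [W.IsGloballyMinimal] (p : ℕ) [Fact p.Prime]
    (hirr : W.HasIrreducibleModPGaloisRep p)
    {N : ℕ} [NeZero N] (K : Type) [Field K] [NumberField K] (hK : IsImaginaryQuadratic K)
    (hHH : SatisfiesHeegnerHypothesis N K) (Dt : ModularParametrizationData W N)
    (H : HeegnerDatum N (NumberField.discr K)) (ι : K →+* ℂ) (P : (W.baseChange K).toAffine.Point)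
    (hP : WeierstrassCurve.Affine.Point.map ι.toRatAlgHom P = heegnerPointComplex Dt H)
    (hnt : ¬ IsOfFinAddOrder P) {s : ℕ}
    (hI : padicValNat p W.tamagawaProduct + s ≤ padicValNat p (AddSubgroup.zmultiples P).index)
    (hhigh : ∀ (s' : ℕ), s' ≤ padicValNat p W.tamagawaProduct + s →
      ∀ (n : ℕ) (d : KolyvaginHeegnerData Dt H.β ι n), n ≠ 1 → Squarefree n →
        (∀ ℓ ∈ n.primeFactors, Zhang2014.IsKolyvaginPrime N W K p ℓ ∧
          s' ≤ Zhang2014.kolyvaginIndex W p ℓ) → Koly.PDiv d p s') :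
    ∀ (s' : ℕ), s' ≤ padicValNat p W.tamagawaProduct + s →
      ∀ (n : ℕ) (d : KolyvaginHeegnerData Dt H.β ι n), Squarefree n →
        (∀ ℓ ∈ n.primeFactors, Zhang2014.IsKolyvaginPrime N W K p ℓ ∧
          s' ≤ Zhang2014.kolyvaginIndex W p ℓ) → Koly.PDiv d p s' := by
  intro s' hs' n d hn hℓ
  by_cases h1 : n = 1
  · subst h1
    exact pDiv_one_of_le_padicValNat_index hKo W p hirr K hK hHH Dt H ι P hP hnt d (hs'.trans hI)
  · exact hhigh s' hs' n d h1 hn hℓ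

/-- **JET certificate theorem with the index certificate as an EQUALITY and J at genuine levels only** (any odd
`p`, any reduction, `ρ̄` irreducible non-CM, `r_an ≤ 1`): `ord_p [E(K):ℤP] = ord_p ∏_ℓ c_ℓ(E) + s`, the
divisibility clause for every derived Heegner point of Kolyvagin level `n ≠ 1` (`hhigh`, displayed),
Matar–Nekovář 0.7/§0.11 + Kolyvagin + GZK (named), `#Ш_an(E) = q` with `ord_p q = 0` ⟹ `BSDp W p` (file 4's
`bsdp_of_globalDivisibility_of_index_le_of_shaAnUnit` ∘ §3). CONDITIONAL; per pair; books nothing.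
[cite: Jetchev2008, Conj. 1.3 and Cor. 1.5 (p. 812)] [cite: MatarNekovar2019, Thm. 0.7 (p. 456) and §0.11 (p. 457)]
[cite: McCallumLMS1991, §5 Lemma 5.1 (p. 303)] [cite: Miller2011LMS, Def. 1.1] -/
theorem bsdp_of_higherLevelDivisibility_of_index_eq_of_shaAnUnit
    (hKo : ∀ (N : ℕ) [NeZero N] (W : WeierstrassCurve ℚ) (K : Type) [Field K] [NumberField K],
      kolyvagin N W K)
    (hMN : MatarNekovar2019.thm07_padicValNat_card_sha_primary_add_le_of_globalDivisibility_of_irreducible)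
    (hGZK : rank_eq_analyticRank_of_analyticRank_le_one)
    (W : WeierstrassCurve ℚ) [W.IsElliptic] [W.IsGloballyMinimal] [NeZero (W.conductorNorm ℤ)]
    (hCM : ¬ W.HasCM) (p : ℕ) [Fact p.Prime] (hp2 : p ≠ 2) (hirr : W.HasIrreducibleModPGaloisRep p)
    (hr : W.analyticRank ≤ 1)
    (K : Type) [Field K] [NumberField K] (hK : IsImaginaryQuadratic K)
    (h3 : NumberField.discr K ≠ -3) (h4 : NumberField.discr K ≠ -4)
    (hHH : SatisfiesHeegnerHypothesis (W.conductorNorm ℤ) K)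
    (Dt : ModularParametrizationData W (W.conductorNorm ℤ))
    (H : HeegnerDatum (W.conductorNorm ℤ) (NumberField.discr K)) (ι : K →+* ℂ)
    (P : (W.baseChange K).toAffine.Point)
    (hP : WeierstrassCurve.Affine.Point.map ι.toRatAlgHom P = heegnerPointComplex Dt H)
    (hnt : ¬ IsOfFinAddOrder P) {s : ℕ}
    (hI : padicValNat p (AddSubgroup.zmultiples P).index = padicValNat p W.tamagawaProduct + s)
    (hhigh : ∀ (s' : ℕ), s' ≤ padicValNat p W.tamagawaProduct + s →
      ∀ (n : ℕ) (d : KolyvaginHeegnerData Dt H.β ι n), n ≠ 1 → Squarefree n →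
        (∀ ℓ ∈ n.primeFactors, Zhang2014.IsKolyvaginPrime (W.conductorNorm ℤ) W K p ℓ ∧
          s' ≤ Zhang2014.kolyvaginIndex W p ℓ) → Koly.PDiv d p s')
    {q : ℚ} (hq : shaAn W = (q : ℂ)) (hv : padicValRat p q = 0) :
    BSDp W p :=
  bsdp_of_globalDivisibility_of_index_le_of_shaAnUnit hKo hMN hGZK W hCM p hp2 hirr hr K hK h3 h4 hHH Dt H ι P
    hP hnt (globalDivisibility_of_index_ge_of_higherLevels hKo W p hirr K hK hHH Dt H ι P hP hnt hI.ge hhigh)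
    hI.le hq hv

end Summit.BirchSwinnertonDyer.BirchSwinnertonDyer.Theorems.SchneiderFree.Exact

end
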